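import Mathlib
import Summits.ResolutionOfSingularities.ResolutionOfSingularities.Theorems.WildQuotientsWildQuotientResolutionJordanFiveFrameDefs

/-!
# RUNG V5 (J₅): the powers of `I₁₂` are the weight filtration — `x^e ∈ I₁₂^N` whenever `4e_a + 3e_b + 2e_c + e_d ≥ 12N`

(crux stmt-ResolutionOfSingularities-15640 `WildQuotients.WildQuotientResolution`, line `Sketch`;
chain w45c RUNG V5 (`L/w45c/CHAIN.md` v8.1), res-L1-w45c-plan-1 PLANNER NOTE 2026-08-27T11:18:44Z
(statement + two-case proof) / NAMING 11:35:13Z («stub-1 = … + `…JordanFiveI12Powers`»), machine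
confirmations res-L1-w45c-tri-2 11:21:02Z (72 365 pairs, box `e ≤ (6,8,12,24)`) and this seat
(`work/sym/idp.py`, `box.py`). Over res-L1-w45c-lead-1's `JordanFive.gens12 / exps12 / I12` (p523816).
[OURS · L1 W4.5c] — NOT a statement of any manuscript (Hironaka 2017 is consumed nowhere); replaces
the role of no printed item. Prover res-L1-w45c-stub-1. AI-written Lean, kernel-checked; weaker than
expert review.)

WHY (HP₁ pipeline): the inverse dictionary of the universal twisted chart needs `F ∈ I₁₂^μ` for
`F = Δ₇H′, MΔ₇, U₈ (μ = 2), x_a²Δ₇T′ (3), x_aΔ₇²H′ (4), Δ₇³T′H′ (6)` — thousands of monomials, so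
membership is taken from WEIGHTS: `mem_I12_pow_of_forall_le_weight`.

PROOF (plan-1's two cases); weight `4e_a + 3e_b + 2e_c + e_d` spelt out (no new definition).
* `exists_sub_le_of_weight` — the combinatorial core: if `12 ≤ weight` then there is
  `(α',β',γ',δ') ≤ (e_a,e_b,e_c,e_d)` with `x_a^{α'}x_b^{β'}x_c^{γ'}x_d^{δ'} ∈ I₁₂` and EITHER weight
  exactly `12` OR (`weight e < 18` and `4α'+3β'+2γ'+δ' ≤ weight e`). Peel a pure power `x_a³, x_b⁴, x_c⁶,
  x_d¹²` (weight `12`) when `e_a ≥ 3 ∨ e_b ≥ 4 ∨ e_c ≥ 6 ∨ e_d ≥ 12`; otherwise `e ≤ (2,3,5,11)` and an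
  explicit `(α,β)`-decision tree exhibits a weight-`12` sub-vector whenever the weight is `≥ 18` (all
  `34` weight-`12` vectors ARE generators: `monomial_mem_I12_of_weight_eq`), the eight residual shapes
  of weight `13–17` being generators `g₃₄ … g₃₉` themselves.
* `monomial_mem_I12_pow_of_weight` — induction on `N`, peeling one such sub-monomial per step (the
  slack bookkeeping is exact: weight `12` costs nothing, and the residual shapes only occur at `N = 1`).
* `mem_I12_pow_of_forall_le_weight` — for an arbitrary polynomial through its support.
-/

-- single-problem summit: the doubled namespace component `ResolutionOfSingularities` is forced
set_option linter.dupNamespace false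

noncomputable section

open MvPolynomial

namespace Summit.ResolutionOfSingularities.ResolutionOfSingularities.Theorems.WildQuotientResolution.JordanFive

variable (k : Type) [Field k] (n : ℕ) (a b c d : Fin n)
  (hab : a ≠ b) (hac : a ≠ c) (had : a ≠ d) (hbc : b ≠ c) (hbd : b ≠ d) (hcd : c ≠ d)

/-- **Every monomial of weight EXACTLY `12` lies in `I₁₂`** — the `34` weight-`12` exponent vectors
are precisely the weight-`12` entries of `exps12`. [OURS · L1 W4.5c] -/
theorem monomial_mem_I12_of_weight_eq (α β γ δ : ℕ) (h : 4 * α + 3 * β + 2 * γ + δ = 12) :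
    (X a ^ α * X b ^ β * X c ^ γ * X d ^ δ : MvPolynomial (Fin n) k) ∈ I12 k n a b c d := by
  obtain rfl : δ = 12 - (4 * α + 3 * β + 2 * γ) := by omega
  have hα : α ≤ 3 := by omega
  have hβ : β ≤ 4 := by omega
  have hγ : γ ≤ 6 := by omega
  unfold I12
  interval_cases α <;> interval_cases β <;> interval_cases γ <;> (try (exfalso; omega)) <;>
    simp only [pow_zero, pow_one, one_mul, mul_one, Nat.reduceMul, Nat.reduceAdd, Nat.reduceSub]
  · exact Ideal.subset_span ⟨3, rfl⟩
  · exact Ideal.subset_span ⟨33, rfl⟩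
  · exact Ideal.subset_span ⟨32, rfl⟩
  · exact Ideal.subset_span ⟨31, rfl⟩
  · exact Ideal.subset_span ⟨30, rfl⟩
  · exact Ideal.subset_span ⟨29, rfl⟩
  · exact Ideal.subset_span ⟨2, rfl⟩
  · exact Ideal.subset_span ⟨28, rfl⟩
  · exact Ideal.subset_span ⟨27, rfl⟩
  · exact Ideal.subset_span ⟨26, rfl⟩
  · exact Ideal.subset_span ⟨25, rfl⟩
  · exact Ideal.subset_span ⟨24, rfl⟩
  · exact Ideal.subset_span ⟨23, rfl⟩
  · exact Ideal.subset_span ⟨22, rfl⟩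
  · exact Ideal.subset_span ⟨21, rfl⟩
  · exact Ideal.subset_span ⟨20, rfl⟩
  · exact Ideal.subset_span ⟨19, rfl⟩
  · exact Ideal.subset_span ⟨18, rfl⟩
  · exact Ideal.subset_span ⟨1, rfl⟩
  · exact Ideal.subset_span ⟨17, rfl⟩
  · exact Ideal.subset_span ⟨16, rfl⟩
  · exact Ideal.subset_span ⟨15, rfl⟩
  · exact Ideal.subset_span ⟨14, rfl⟩
  · exact Ideal.subset_span ⟨13, rfl⟩
  · exact Ideal.subset_span ⟨12, rfl⟩
  · exact Ideal.subset_span ⟨11, rfl⟩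
  · exact Ideal.subset_span ⟨10, rfl⟩
  · exact Ideal.subset_span ⟨9, rfl⟩
  · exact Ideal.subset_span ⟨8, rfl⟩
  · exact Ideal.subset_span ⟨7, rfl⟩
  · exact Ideal.subset_span ⟨6, rfl⟩
  · exact Ideal.subset_span ⟨5, rfl⟩
  · exact Ideal.subset_span ⟨4, rfl⟩
  · exact Ideal.subset_span ⟨0, rfl⟩

/-- The six generators of weight `13`/`14`: `x_a²x_bx_c, x_ax_b³, x_ax_bx_c³, x_b³x_c², x_bx_c⁵,
x_a²x_b²`. [OURS · L1 W4.5c] -/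
theorem monomial_mem_I12_of_heavy (α β γ δ : ℕ)
    (h : (α = 2 ∧ β = 1 ∧ γ = 1 ∧ δ = 0) ∨ (α = 1 ∧ β = 3 ∧ γ = 0 ∧ δ = 0) ∨
      (α = 1 ∧ β = 1 ∧ γ = 3 ∧ δ = 0) ∨ (α = 0 ∧ β = 3 ∧ γ = 2 ∧ δ = 0) ∨
      (α = 0 ∧ β = 1 ∧ γ = 5 ∧ δ = 0) ∨ (α = 2 ∧ β = 2 ∧ γ = 0 ∧ δ = 0)) :
    (X a ^ α * X b ^ β * X c ^ γ * X d ^ δ : MvPolynomial (Fin n) k) ∈ I12 k n a b c d := by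
  unfold I12
  rcases h with ⟨rfl, rfl, rfl, rfl⟩ | ⟨rfl, rfl, rfl, rfl⟩ | ⟨rfl, rfl, rfl, rfl⟩ |
    ⟨rfl, rfl, rfl, rfl⟩ | ⟨rfl, rfl, rfl, rfl⟩ | ⟨rfl, rfl, rfl, rfl⟩ <;>
    simp only [pow_zero, pow_one, one_mul, mul_one]
  · exact Ideal.subset_span ⟨34, rfl⟩
  · exact Ideal.subset_span ⟨35, rfl⟩
  · exact Ideal.subset_span ⟨36, rfl⟩
  · exact Ideal.subset_span ⟨37, rfl⟩
  · exact Ideal.subset_span ⟨38, rfl⟩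
  · exact Ideal.subset_span ⟨39, rfl⟩

/-- **The combinatorial core.** If `4α + 3β + 2γ + δ ≥ 12` there is `(α',β',γ',δ') ≤ (α,β,γ,δ)` whose
monomial lies in `I₁₂` and whose weight is EXACTLY `12` — unless the total weight is `< 18`, in which
case only `4α'+3β'+2γ'+δ' ≤ 4α+3β+2γ+δ` is guaranteed (the eight residual shapes). [OURS · L1 W4.5c] -/
theorem exists_sub_le_of_weight (α β γ δ : ℕ) (h : 12 ≤ 4 * α + 3 * β + 2 * γ + δ) :
    ∃ α' β' γ' δ' : ℕ, α' ≤ α ∧ β' ≤ β ∧ γ' ≤ γ ∧ δ' ≤ δ ∧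
      (X a ^ α' * X b ^ β' * X c ^ γ' * X d ^ δ' : MvPolynomial (Fin n) k) ∈ I12 k n a b c d ∧
      (4 * α' + 3 * β' + 2 * γ' + δ' = 12 ∨
        (4 * α + 3 * β + 2 * γ + δ < 18 ∧ 4 * α' + 3 * β' + 2 * γ' + δ' ≤ 4 * α + 3 * β + 2 * γ + δ)) := by
  have h12 := monomial_mem_I12_of_weight_eq k n a b c d
  have h13 := monomial_mem_I12_of_heavy k n a b c d
  -- pure powers
  by_cases hα : 3 ≤ α
  · exact ⟨3, 0, 0, 0, hα, Nat.zero_le _, Nat.zero_le _, Nat.zero_le _, h12 3 0 0 0 rfl, Or.inl rfl⟩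
  by_cases hβ : 4 ≤ β
  · exact ⟨0, 4, 0, 0, Nat.zero_le _, hβ, Nat.zero_le _, Nat.zero_le _, h12 0 4 0 0 rfl, Or.inl rfl⟩
  by_cases hγ : 6 ≤ γ
  · exact ⟨0, 0, 6, 0, Nat.zero_le _, Nat.zero_le _, hγ, Nat.zero_le _, h12 0 0 6 0 rfl, Or.inl rfl⟩
  by_cases hδ : 12 ≤ δ
  · exact ⟨0, 0, 0, 12, Nat.zero_le _, Nat.zero_le _, Nat.zero_le _, hδ, h12 0 0 0 12 rfl, Or.inl rfl⟩
  simp only [not_le] at hα hβ hγ hδ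
  -- the box `α ≤ 2, β ≤ 3, γ ≤ 5, δ ≤ 11`
  interval_cases α <;> interval_cases β
  · -- (0,0): weight-12 sub-vector (0,0,γ,12-2γ)
    exact ⟨0, 0, γ, 12 - 2 * γ, le_rfl, le_rfl, le_rfl, by omega, h12 0 0 γ (12 - 2 * γ) (by omega),
      Or.inl (by omega)⟩
  · -- (0,1)
    by_cases hγ4 : γ ≤ 4
    · by_cases hd : 9 - 2 * γ ≤ δ
      · exact ⟨0, 1, γ, 9 - 2 * γ, le_rfl, le_rfl, le_rfl, hd, h12 0 1 γ (9 - 2 * γ) (by omega),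
          Or.inl (by omega)⟩
      · exact ⟨0, 0, γ, 12 - 2 * γ, le_rfl, by omega, le_rfl, by omega, h12 0 0 γ (12 - 2 * γ) (by omega),
          Or.inl (by omega)⟩
    · obtain rfl : γ = 5 := by omega
      by_cases hd : 1 ≤ δ
      · exact ⟨0, 1, 4, 1, le_rfl, le_rfl, by omega, hd, h12 0 1 4 1 rfl, Or.inl rfl⟩
      · exact ⟨0, 1, 5, 0, le_rfl, le_rfl, le_rfl, Nat.zero_le _,
          h13 0 1 5 0 (Or.inr (Or.inr (Or.inr (Or.inr (Or.inl ⟨rfl, rfl, rfl, rfl⟩))))), Or.inr (by omega)⟩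
  · -- (0,2)
    by_cases hγ3 : γ ≤ 3
    · by_cases hd : 6 - 2 * γ ≤ δ
      · exact ⟨0, 2, γ, 6 - 2 * γ, le_rfl, le_rfl, le_rfl, hd, h12 0 2 γ (6 - 2 * γ) (by omega),
          Or.inl (by omega)⟩
      · exact ⟨0, 0, γ, 12 - 2 * γ, le_rfl, by omega, le_rfl, by omega, h12 0 0 γ (12 - 2 * γ) (by omega),
          Or.inl (by omega)⟩
    · exact ⟨0, 2, 3, 0, le_rfl, le_rfl, by omega, Nat.zero_le _, h12 0 2 3 0 rfl, Or.inl rfl⟩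
  · -- (0,3)
    by_cases hγ1 : 1 ≤ γ
    · by_cases hd : 1 ≤ δ
      · exact ⟨0, 3, 1, 1, le_rfl, le_rfl, hγ1, hd, h12 0 3 1 1 rfl, Or.inl rfl⟩
      · by_cases hγ3 : 3 ≤ γ
        · exact ⟨0, 2, 3, 0, le_rfl, by omega, hγ3, Nat.zero_le _, h12 0 2 3 0 rfl, Or.inl rfl⟩
        · by_cases hγ2 : γ = 2
          · exact ⟨0, 3, 2, 0, le_rfl, le_rfl, by omega, Nat.zero_le _,
              h13 0 3 2 0 (Or.inr (Or.inr (Or.inr (Or.inl ⟨rfl, rfl, rfl, rfl⟩)))), Or.inr (by omega)⟩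
          · exfalso; omega
    · by_cases hd : 3 ≤ δ
      · exact ⟨0, 3, 0, 3, le_rfl, le_rfl, Nat.zero_le _, hd, h12 0 3 0 3 rfl, Or.inl rfl⟩
      · exfalso; omega
  · -- (1,0)
    by_cases hγ4 : γ ≤ 4
    · by_cases hd : 8 - 2 * γ ≤ δ
      · exact ⟨1, 0, γ, 8 - 2 * γ, le_rfl, le_rfl, le_rfl, hd, h12 1 0 γ (8 - 2 * γ) (by omega),
          Or.inl (by omega)⟩
      · exact ⟨0, 0, γ, 12 - 2 * γ, by omega, le_rfl, le_rfl, by omega, h12 0 0 γ (12 - 2 * γ) (by omega),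
          Or.inl (by omega)⟩
    · exact ⟨1, 0, 4, 0, le_rfl, le_rfl, by omega, Nat.zero_le _, h12 1 0 4 0 rfl, Or.inl rfl⟩
  · -- (1,1)
    by_cases hγ2 : γ ≤ 2
    · by_cases hd : 5 - 2 * γ ≤ δ
      · exact ⟨1, 1, γ, 5 - 2 * γ, le_rfl, le_rfl, le_rfl, hd, h12 1 1 γ (5 - 2 * γ) (by omega),
          Or.inl (by omega)⟩
      · by_cases hd' : 8 - 2 * γ ≤ δ
        · exact ⟨1, 0, γ, 8 - 2 * γ, le_rfl, by omega, le_rfl, hd', h12 1 0 γ (8 - 2 * γ) (by omega),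
            Or.inl (by omega)⟩
        · exfalso; omega
    · by_cases hd : 1 ≤ δ
      · exact ⟨1, 1, 2, 1, le_rfl, le_rfl, by omega, hd, h12 1 1 2 1 rfl, Or.inl rfl⟩
      · by_cases hγ4 : 4 ≤ γ
        · exact ⟨1, 0, 4, 0, le_rfl, by omega, hγ4, Nat.zero_le _, h12 1 0 4 0 rfl, Or.inl rfl⟩
        · obtain rfl : γ = 3 := by omega
          exact ⟨1, 1, 3, 0, le_rfl, le_rfl, le_rfl, Nat.zero_le _,
            h13 1 1 3 0 (Or.inr (Or.inr (Or.inl ⟨rfl, rfl, rfl, rfl⟩))), Or.inr (by omega)⟩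
  · -- (1,2)
    by_cases hγ1 : 1 ≤ γ
    · exact ⟨1, 2, 1, 0, le_rfl, le_rfl, hγ1, Nat.zero_le _, h12 1 2 1 0 rfl, Or.inl rfl⟩
    · by_cases hd : 2 ≤ δ
      · exact ⟨1, 2, 0, 2, le_rfl, le_rfl, Nat.zero_le _, hd, h12 1 2 0 2 rfl, Or.inl rfl⟩
      · exfalso; omega
  · -- (1,3)
    by_cases hγ1 : 1 ≤ γ
    · exact ⟨1, 2, 1, 0, le_rfl, by omega, hγ1, Nat.zero_le _, h12 1 2 1 0 rfl, Or.inl rfl⟩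
    · by_cases hd : 2 ≤ δ
      · exact ⟨1, 2, 0, 2, le_rfl, by omega, Nat.zero_le _, hd, h12 1 2 0 2 rfl, Or.inl rfl⟩
      · exact ⟨1, 3, 0, 0, le_rfl, le_rfl, Nat.zero_le _, Nat.zero_le _,
          h13 1 3 0 0 (Or.inr (Or.inl ⟨rfl, rfl, rfl, rfl⟩)), Or.inr (by omega)⟩
  · -- (2,0)
    by_cases hγ2 : 2 ≤ γ
    · exact ⟨2, 0, 2, 0, le_rfl, le_rfl, hγ2, Nat.zero_le _, h12 2 0 2 0 rfl, Or.inl rfl⟩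
    · by_cases hγ1 : γ = 1
      · subst hγ1
        by_cases hd : 2 ≤ δ
        · exact ⟨2, 0, 1, 2, le_rfl, le_rfl, le_rfl, hd, h12 2 0 1 2 rfl, Or.inl rfl⟩
        · exfalso; omega
      · by_cases hd : 4 ≤ δ
        · exact ⟨2, 0, 0, 4, le_rfl, le_rfl, Nat.zero_le _, hd, h12 2 0 0 4 rfl, Or.inl rfl⟩
        · exfalso; omega
  · -- (2,1)
    by_cases hd : 1 ≤ δ
    · exact ⟨2, 1, 0, 1, le_rfl, le_rfl, Nat.zero_le _, hd, h12 2 1 0 1 rfl, Or.inl rfl⟩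
    · by_cases hγ2 : 2 ≤ γ
      · exact ⟨2, 0, 2, 0, le_rfl, by omega, hγ2, Nat.zero_le _, h12 2 0 2 0 rfl, Or.inl rfl⟩
      · by_cases hγ1 : γ = 1
        · exact ⟨2, 1, 1, 0, le_rfl, le_rfl, by omega, Nat.zero_le _, h13 2 1 1 0 (Or.inl ⟨rfl, rfl, rfl, rfl⟩),
            Or.inr (by omega)⟩
        · exfalso; omega
  · -- (2,2)
    by_cases hd : 1 ≤ δ
    · exact ⟨2, 1, 0, 1, le_rfl, by omega, Nat.zero_le _, hd, h12 2 1 0 1 rfl, Or.inl rfl⟩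
    · by_cases hγ2 : 2 ≤ γ
      · exact ⟨2, 0, 2, 0, le_rfl, by omega, hγ2, Nat.zero_le _, h12 2 0 2 0 rfl, Or.inl rfl⟩
      · by_cases hγ1 : γ = 1
        · exact ⟨1, 2, 1, 0, by omega, le_rfl, by omega, Nat.zero_le _, h12 1 2 1 0 rfl, Or.inl rfl⟩
        · exact ⟨2, 2, 0, 0, le_rfl, le_rfl, Nat.zero_le _, Nat.zero_le _,
            h13 2 2 0 0 (Or.inr (Or.inr (Or.inr (Or.inr (Or.inr ⟨rfl, rfl, rfl, rfl⟩))))), Or.inr (by omega)⟩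
  · -- (2,3)
    by_cases hd : 1 ≤ δ
    · exact ⟨2, 1, 0, 1, le_rfl, by omega, Nat.zero_le _, hd, h12 2 1 0 1 rfl, Or.inl rfl⟩
    · by_cases hγ1 : 1 ≤ γ
      · exact ⟨1, 2, 1, 0, by omega, by omega, hγ1, Nat.zero_le _, h12 1 2 1 0 rfl, Or.inl rfl⟩
      · exact ⟨2, 2, 0, 0, le_rfl, by omega, Nat.zero_le _, Nat.zero_le _,
          h13 2 2 0 0 (Or.inr (Or.inr (Or.inr (Or.inr (Or.inr ⟨rfl, rfl, rfl, rfl⟩))))), Or.inr (by omega)⟩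

include hab hac had hbc hbd hcd in
/-- **`x^e ∈ I₁₂^N` whenever `4e_a + 3e_b + 2e_c + e_d ≥ 12N`** — the `I₁₂`-adic and the weight
filtrations agree on monomials. [OURS · L1 W4.5c] -/
theorem monomial_mem_I12_pow_of_weight (N : ℕ) (e : Fin n →₀ ℕ) (h : 12 * N ≤ 4 * e a + 3 * e b + 2 * e c + e d) :
    monomial e (1 : k) ∈ I12 k n a b c d ^ N := by
  classical
  induction N generalizing e with
  | zero => rw [pow_zero, Ideal.one_eq_top]; exact Submodule.mem_top
  | succ N ih =>
    obtain ⟨α', β', γ', δ', hα, hβ, hγ, hδ, hmem, hw⟩ :=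
      exists_sub_le_of_weight k n a b c d (e a) (e b) (e c) (e d) (by omega)
    -- the sub-vector `g` and the remainder `e - g`
    let g : Fin n →₀ ℕ :=
      Finsupp.single a α' + Finsupp.single b β' + Finsupp.single c γ' + Finsupp.single d δ'
    have hga : g a = α' := by simp [g, hab, hac, had]
    have hgb : g b = β' := by simp [g, hab.symm, hbc, hbd]
    have hgc : g c = γ' := by simp [g, hac.symm, hbc.symm, hcd]
    have hgd : g d = δ' := by simp [g, had.symm, hbd.symm, hcd.symm]
    have hg0 : ∀ i, i ≠ a → i ≠ b → i ≠ c → i ≠ d → g i = 0 := by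
      intro i hia hib hic hid; simp [g, hia, hib, hic, hid]
    have hle : g ≤ e := by
      intro i
      by_cases hia : i = a
      · subst hia; rw [hga]; exact hα
      by_cases hib : i = b
      · subst hib; rw [hgb]; exact hβ
      by_cases hic : i = c
      · subst hic; rw [hgc]; exact hγ
      by_cases hid : i = d
      · subst hid; rw [hgd]; exact hδ
      rw [hg0 i hia hib hic hid]; exact Nat.zero_le _
    have hsplit : monomial e (1 : k) = monomial (e - g) 1 * monomial g 1 := by
      rw [monomial_mul, one_mul, tsub_add_cancel_of_le hle]
    have hmon : monomial g (1 : k) = X a ^ α' * X b ^ β' * X c ^ γ' * X d ^ δ' := by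
      simp only [g, X_pow_eq_monomial, monomial_mul, one_mul]
    have hrest : 12 * N ≤ 4 * (e - g) a + 3 * (e - g) b + 2 * (e - g) c + (e - g) d := by
      simp only [Finsupp.tsub_apply, hga, hgb, hgc, hgd]
      rcases hw with hw | ⟨hlt, hle'⟩
      · omega
      · have hN : N = 0 := by omega
        subst hN; omega
    rw [hsplit, pow_succ]
    exact Ideal.mul_mem_mul (ih (e - g) hrest) (hmon ▸ hmem)

include hab hac had hbc hbd hcd in
/-- The case `N = 1`: **a monomial of weight `≥ 12` lies in `I₁₂`.** [OURS · L1 W4.5c] -/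
theorem monomial_mem_I12_of_weight (e : Fin n →₀ ℕ) (h : 12 ≤ 4 * e a + 3 * e b + 2 * e c + e d) :
    monomial e (1 : k) ∈ I12 k n a b c d := by
  have h1 := monomial_mem_I12_pow_of_weight k n a b c d hab hac had hbc hbd hcd 1 e (by omega)
  rwa [pow_one] at h1

include hab hac had hbc hbd hcd in
/-- **A polynomial all of whose monomials have weight `≥ 12N` lies in `I₁₂^N`.** [OURS · L1 W4.5c] -/
theorem mem_I12_pow_of_forall_le_weight (N : ℕ) (F : MvPolynomial (Fin n) k)
    (hF : ∀ e, coeff e F ≠ 0 → 12 * N ≤ 4 * e a + 3 * e b + 2 * e c + e d) : F ∈ I12 k n a b c d ^ N := by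
  classical
  rw [F.as_sum]
  refine Ideal.sum_mem _ fun e he => ?_
  have e1 : monomial e (coeff e F) = C (coeff e F) * monomial e 1 := by
    rw [C_mul_monomial, mul_one]
  rw [e1]
  exact Ideal.mul_mem_left _ _
    (monomial_mem_I12_pow_of_weight k n a b c d hab hac had hbc hbd hcd N e (hF e (mem_support_iff.mp he)))

end Summit.ResolutionOfSingularities.ResolutionOfSingularities.Theorems.WildQuotientResolution.JordanFive

end
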